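import Mathlib
import HarnessLib
import Summits.HubbardSuperconductivity.HubbardSuperconductivity.Theorems.ComplexGFFStiffnessHypACumulantHolomorphicPointwise
import Summits.HubbardSuperconductivity.HubbardSuperconductivity.Theorems.ComplexGFFStiffnessHypACumulantHolomorphicCoeffNorm
import Literature.MathematicalPhysics.StatisticalMechanics.PolymerNorms

/-!
# Crux `HypACumulant`, line `gnv` — ASSEMBLY of (C3d′): polymer-norm Lipschitz and parallelogram bounds along
# complex lines from POINTWISE holomorphy, per-parameter smoothness and a UNIFORM norm bound only

Route `route-HubbardSuperconductivity-ComplexGFFStiffness`, cruxes stmt-HubbardSuperconductivity-19154 /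
-19155, shared research statement `OnePointLipschitz`, census (C3d′) (memo §8, step S6b).  Final, user-facing
form of the holomorphic toolchain for the weak polymer norm `‖·‖_k^{(A)}` ([ABKM19] (6.48)–(6.50)): for a
family of polymer activities `K_σ` (resp. `K_{σ,τ}`) on the disc `|σ| < R` (bidisc) such that

* `σ ↦ K_σ(X, ψ)` is holomorphic for every polymer `X` and field `ψ` (pointwise; for `S_k` along
  `(H + σU, K + σV)` this is `…HolomorphicNextKStep.differentiableOn_nextKStep_line`),
* `K_σ(X, ·)` is `C^{r₀}` for each `σ` in the disc (the tree: `RenormalisationMapSummandsSmooth`),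
* the weights `w_k^X` are continuous in the field (true for the torus tower: exponentials of quadratic forms),
* a UNIFORM bound `‖K_σ‖_k ≤ C` on the disc ([ABKM19] Theorem 6.8 on the complex ball),

one gets `‖K_σ − K_0‖_k ≤ (r₀+1)(2C/R)|σ|` (`weakNormLE_sub_of_pointwise_holomorphic`) and the parallelogram
bound `‖K_{σ,τ} − K_{σ,0} − K_{0,τ} + K_{0,0}‖_k ≤ (r₀+1)(4C/R²)|σ||τ|`
(`weakNormLE_secondDiff_of_pointwise_holomorphic`).  The coefficient holomorphy required by
`…HolomorphicCoeffNorm` is produced by `…HolomorphicPointwise` from the local jet bounds that the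
uniform norm bound and the continuity of the weights provide (`coeff_holomorphic_of_pointwise`).
All proved, no `sorry`.

## References
* S. Adams, S. Buchholz, R. Kotecký, S. Müller, arXiv:1910.13564, Ch. 6.4 (6.48)–(6.50), Theorem 6.8, Ch. 10–11
  [AdamsBuchholzKoteckyMuller2019].
-/

noncomputable section

-- `Summit.<Summit>.<Problem>`: single-conjunct summit, the duplicate component is mandated (D-0017).
set_option linter.dupNamespace false

namespace Summit.HubbardSuperconductivity.HubbardSuperconductivity.Theorems.ComplexGFF

open Metric Set Filter Topology
open Literature.MathematicalPhysics.StatisticalMechanics.GradientRG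
open Literature.MathematicalPhysics.StatisticalMechanics.TorusPolymer (IsPolymer)
open Literature.Barriers.CriticalPhenomena.LongRangePhi4.Polymer (IsConn)

section Coeff

variable {E V : Type*} [NormedAddCommGroup E] [NormedSpace ℝ E] [FiniteDimensional ℝ E]
  [NormedAddCommGroup V] [NormedSpace ℝ V]

/-- **Coefficient holomorphy from pointwise holomorphy and a uniform weighted Taylor-norm bound.**  For a
family `K : ℂ → E → ℂ`, holomorphic in `σ` pointwise on an open `U`, `C^{r₀}` for `σ ∈ U`, with
`‖K σ‖_{T,w} ≤ C` (`TayNormLE`) uniformly on `U` and a continuous weight `w`: every lifted Taylor coefficient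
`σ ↦ D^s (K σ)‾(u)(v)`, `s ≤ r₀`, is holomorphic on `U`. -/
theorem coeff_holomorphic_of_pointwise {U : Set ℂ} (hU : IsOpen U) (T : E →ₗ[ℝ] V) {r₀ : ℕ} {w : E → ℝ}
    (hw : Continuous w) {K : ℂ → E → ℂ} {C : ℝ}
    (hhol : ∀ ψ : E, DifferentiableOn ℂ (fun σ => K σ ψ) U)
    (hKc : ∀ σ ∈ U, ContDiff ℝ (r₀ : WithTop ℕ∞) (K σ))
    (hC : ∀ σ ∈ U, TayNormLE T r₀ w (K σ) C) (s : ℕ) (hs : s ≤ r₀)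
    (u : LinearMap.range T) (v : Fin s → LinearMap.range T) :
    DifferentiableOn ℂ (fun σ => iteratedFDeriv ℝ s (gaugeLift T (K σ)) u v) U := by
  refine differentiableOn_iteratedFDeriv_apply_of_pointwise hU (F := fun σ => gaugeLift T (K σ)) (n := r₀)
    (fun u' => hhol (gaugeSection T u')) (fun σ hσ => contDiff_gaugeLift T (hKc σ hσ)) ?_ s hs u v
  intro s' hs' σ₀ hσ₀ u₀
  -- a closed disc inside `U` and a bound of the weight along the section near `u₀`
  obtain ⟨r, hr, hsub⟩ : ∃ r > 0, closedBall σ₀ r ⊆ U := by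
    obtain ⟨ε, hε, hεU⟩ := Metric.isOpen_iff.mp hU σ₀ hσ₀
    exact ⟨ε / 2, half_pos hε, (closedBall_subset_ball (half_lt_self hε)).trans hεU⟩
  have hcont : ContinuousOn (fun u' : LinearMap.range T => w (gaugeSection T u')) (closedBall u₀ 1) :=
    (hw.comp (gaugeSectionCLM T).continuous).continuousOn
  obtain ⟨Bw, hBw⟩ := (isCompact_closedBall u₀ (1 : ℝ)).exists_bound_of_continuousOn hcont
  refine ⟨r, hr, 1, one_pos, (s'.factorial : ℝ) * |C| * Bw, hsub, fun σ hσ u' hu' => ?_⟩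
  have hσU : σ ∈ U := hsub hσ
  have hpt : T.rangeRestrict (gaugeSection T u') = u' := rangeRestrict_gaugeSection T u'
  have h1 : ‖iteratedFDeriv ℝ s' (gaugeLift T (K σ)) u'‖ ≤ (s'.factorial : ℝ) * tayNorm T r₀ (K σ) (gaugeSection T u') := by
    have h := norm_iteratedFDeriv_gaugeLift_le_factorial_mul_tayNorm T r₀ (K σ) (gaugeSection T u') hs'
    rwa [hpt] at h
  have h2 : tayNorm T r₀ (K σ) (gaugeSection T u') ≤ C * w (gaugeSection T u') := hC σ hσU _
  have h3 : ‖w (gaugeSection T u')‖ ≤ Bw := hBw u' (ball_subset_closedBall hu')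
  have h4 : C * w (gaugeSection T u') ≤ |C| * Bw := by
    calc C * w (gaugeSection T u') ≤ |C * w (gaugeSection T u')| := le_abs_self _
      _ = |C| * |w (gaugeSection T u')| := abs_mul _ _
      _ ≤ |C| * Bw := mul_le_mul_of_nonneg_left (by simpa [Real.norm_eq_abs] using h3) (abs_nonneg C)
  calc ‖iteratedFDeriv ℝ s' (gaugeLift T (K σ)) u'‖ ≤ (s'.factorial : ℝ) * tayNorm T r₀ (K σ) (gaugeSection T u') := h1
    _ ≤ (s'.factorial : ℝ) * (|C| * Bw) := mul_le_mul_of_nonneg_left (h2.trans h4) (Nat.cast_nonneg _)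
    _ = (s'.factorial : ℝ) * |C| * Bw := by ring

end Coeff

section Polymer

variable {d M : ℕ} [NeZero M]

/-- **`‖K_σ − K_0‖_k ≤ (r₀+1)(2C/R)|σ|` from pointwise holomorphy, per-`σ` smoothness, continuous weights and a
uniform weak-norm bound on the disc.** -/
theorem weakNormLE_sub_of_pointwise_holomorphic (P : NormParams d M) (k : ℕ)
    (hw : ∀ X, Continuous (P.W.weight k X))
    {K : ℂ → Finset (Fin d → ZMod M) → ((Fin d → ZMod M) → ℝ) → ℂ} {R C : ℝ}
    (hhol : ∀ X ψ, DifferentiableOn ℂ (fun σ => K σ X ψ) (ball (0 : ℂ) R))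
    (hKc : ∀ σ ∈ ball (0 : ℂ) R, ∀ X, ContDiff ℝ (P.r₀ : WithTop ℕ∞) (K σ X))
    (hC : ∀ σ ∈ ball (0 : ℂ) R, WeakNormLE P k (K σ) C) {σ : ℂ} (hσ : σ ∈ ball (0 : ℂ) R) :
    WeakNormLE P k (fun X ψ => K σ X ψ - K 0 X ψ) (((P.r₀ : ℝ) + 1) * (2 * C / R) * ‖σ‖) := by
  classical
  have hR : 0 < R := lt_of_le_of_lt (norm_nonneg σ) (mem_ball_zero_iff.mp hσ)
  have h0 : (0 : ℂ) ∈ ball (0 : ℂ) R := mem_ball_self hR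
  -- modify the family outside the disc (irrelevant for the conclusion) to have global smoothness
  set K' : ℂ → Finset (Fin d → ZMod M) → ((Fin d → ZMod M) → ℝ) → ℂ :=
    fun σ' => if σ' ∈ ball (0 : ℂ) R then K σ' else K 0 with hK'
  have hK'eq : ∀ σ' ∈ ball (0 : ℂ) R, K' σ' = K σ' := fun σ' hσ' => by
    show (if σ' ∈ ball (0 : ℂ) R then K σ' else K 0) = K σ'
    rw [if_pos hσ']
  have hK'c : ∀ σ' X, ContDiff ℝ (P.r₀ : WithTop ℕ∞) (gaugeLift (P.gauge k X) (K' σ' X)) := by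
    intro σ' X
    by_cases h : σ' ∈ ball (0 : ℂ) R
    · rw [hK'eq σ' h]; exact contDiff_gaugeLift _ (hKc σ' h X)
    · have : K' σ' = K 0 := by
        show (if σ' ∈ ball (0 : ℂ) R then K σ' else K 0) = K 0
        rw [if_neg h]
      rw [this]; exact contDiff_gaugeLift _ (hKc 0 h0 X)
  have hC' : ∀ σ' ∈ ball (0 : ℂ) R, WeakNormLE P k (K' σ') C := fun σ' hσ' => by rw [hK'eq σ' hσ']; exact hC σ' hσ'
  intro X hX hXc φ
  have hT : ∀ σ' ∈ ball (0 : ℂ) R, TayNormLE (P.gauge k X) P.r₀ (P.W.weight k X) (K' σ' X) (C * P.aFactor k X) :=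
    fun σ' hσ' => hC' σ' hσ' X hX hXc
  have hhol' : ∀ ψ, DifferentiableOn ℂ (fun σ' => K' σ' X ψ) (ball (0 : ℂ) R) :=
    fun ψ => (hhol X ψ).congr (fun σ' hσ' => by simp only [hK'eq σ' hσ'])
  have hcoef : ∀ s : ℕ, s ≤ P.r₀ → ∀ v : Fin s → LinearMap.range (P.gauge k X),
      DifferentiableOn ℂ (fun σ' => iteratedFDeriv ℝ s (gaugeLift (P.gauge k X) (K' σ' X))
        ((P.gauge k X).rangeRestrict φ) v) (ball (0 : ℂ) R) :=
    fun s hs' v => coeff_holomorphic_of_pointwise isOpen_ball (P.gauge k X) (hw X) (K := fun σ' => K' σ' X)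
      hhol' (fun σ' hσ' => by rw [hK'eq σ' hσ']; exact hKc σ' hσ' X) hT s hs' _ v
  have h := tayNorm_sub_le_of_holomorphic_coeff (P.gauge k X) P.r₀ (K := fun σ' ψ => K' σ' X ψ)
    (M := C * P.aFactor k X * P.W.weight k X φ) (fun σ' => hK'c σ' X) φ hcoef
    (fun σ' hσ' => by have := hT σ' hσ' φ; simpa [mul_assoc] using this) hσ
  have eσ : K' σ X = K σ X := by rw [hK'eq σ hσ]
  have e0 : K' 0 X = K 0 X := by rw [hK'eq 0 h0]
  simp only [eσ, e0] at h
  calc tayNorm (P.gauge k X) P.r₀ (fun ψ => K σ X ψ - K 0 X ψ) φ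
      ≤ ((P.r₀ : ℝ) + 1) * (2 * (C * P.aFactor k X * P.W.weight k X φ) / R) * ‖σ‖ := h
    _ = ((P.r₀ : ℝ) + 1) * (2 * C / R) * ‖σ‖ * P.aFactor k X * P.W.weight k X φ := by ring

/-- **The parallelogram bound `‖K_{σ,τ} − K_{σ,0} − K_{0,τ} + K_{0,0}‖_k ≤ (r₀+1)(4C/R²)|σ||τ|` from pointwise
(separate) holomorphy, per-parameter smoothness, continuous weights and a uniform weak-norm bound on the bidisc.** -/
theorem weakNormLE_secondDiff_of_pointwise_holomorphic (P : NormParams d M) (k : ℕ)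
    (hw : ∀ X, Continuous (P.W.weight k X))
    {K : ℂ → ℂ → Finset (Fin d → ZMod M) → ((Fin d → ZMod M) → ℝ) → ℂ} {R C : ℝ}
    (hholσ : ∀ τ ∈ ball (0 : ℂ) R, ∀ X ψ, DifferentiableOn ℂ (fun σ => K σ τ X ψ) (ball (0 : ℂ) R))
    (hholτ : ∀ σ ∈ ball (0 : ℂ) R, ∀ X ψ, DifferentiableOn ℂ (fun τ => K σ τ X ψ) (ball (0 : ℂ) R))
    (hKc : ∀ σ ∈ ball (0 : ℂ) R, ∀ τ ∈ ball (0 : ℂ) R, ∀ X, ContDiff ℝ (P.r₀ : WithTop ℕ∞) (K σ τ X))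
    (hC : ∀ σ ∈ ball (0 : ℂ) R, ∀ τ ∈ ball (0 : ℂ) R, WeakNormLE P k (K σ τ) C)
    {σ τ : ℂ} (hσ : σ ∈ ball (0 : ℂ) R) (hτ : τ ∈ ball (0 : ℂ) R) :
    WeakNormLE P k (fun X ψ => K σ τ X ψ - K σ 0 X ψ - K 0 τ X ψ + K 0 0 X ψ)
      (((P.r₀ : ℝ) + 1) * (4 * C / R ^ 2) * ‖σ‖ * ‖τ‖) := by
  classical
  have hR : 0 < R := lt_of_le_of_lt (norm_nonneg σ) (mem_ball_zero_iff.mp hσ)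
  have h0 : (0 : ℂ) ∈ ball (0 : ℂ) R := mem_ball_self hR
  -- modify the family outside the bidisc
  set K' : ℂ → ℂ → Finset (Fin d → ZMod M) → ((Fin d → ZMod M) → ℝ) → ℂ :=
    fun σ' τ' => if σ' ∈ ball (0 : ℂ) R ∧ τ' ∈ ball (0 : ℂ) R then K σ' τ' else K 0 0 with hK'
  have hK'eq : ∀ σ' ∈ ball (0 : ℂ) R, ∀ τ' ∈ ball (0 : ℂ) R, K' σ' τ' = K σ' τ' :=
    fun σ' hσ' τ' hτ' => by
      show (if σ' ∈ ball (0 : ℂ) R ∧ τ' ∈ ball (0 : ℂ) R then K σ' τ' else K 0 0) = K σ' τ'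
      rw [if_pos ⟨hσ', hτ'⟩]
  have hK'c : ∀ σ' τ' X, ContDiff ℝ (P.r₀ : WithTop ℕ∞) (gaugeLift (P.gauge k X) (K' σ' τ' X)) := by
    intro σ' τ' X
    by_cases h : σ' ∈ ball (0 : ℂ) R ∧ τ' ∈ ball (0 : ℂ) R
    · rw [hK'eq σ' h.1 τ' h.2]; exact contDiff_gaugeLift _ (hKc σ' h.1 τ' h.2 X)
    · have : K' σ' τ' = K 0 0 := by
        show (if σ' ∈ ball (0 : ℂ) R ∧ τ' ∈ ball (0 : ℂ) R then K σ' τ' else K 0 0) = K 0 0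
        rw [if_neg h]
      rw [this]; exact contDiff_gaugeLift _ (hKc 0 h0 0 h0 X)
  intro X hX hXc φ
  have hT : ∀ σ' ∈ ball (0 : ℂ) R, ∀ τ' ∈ ball (0 : ℂ) R,
      TayNormLE (P.gauge k X) P.r₀ (P.W.weight k X) (K' σ' τ' X) (C * P.aFactor k X) :=
    fun σ' hσ' τ' hτ' => by rw [hK'eq σ' hσ' τ' hτ']; exact hC σ' hσ' τ' hτ' X hX hXc
  have hcoefσ : ∀ s : ℕ, s ≤ P.r₀ → ∀ v : Fin s → LinearMap.range (P.gauge k X), ∀ τ' ∈ ball (0 : ℂ) R,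
      DifferentiableOn ℂ (fun σ' => iteratedFDeriv ℝ s (gaugeLift (P.gauge k X) (K' σ' τ' X))
        ((P.gauge k X).rangeRestrict φ) v) (ball (0 : ℂ) R) := by
    intro s hs' v τ' hτ'
    refine coeff_holomorphic_of_pointwise isOpen_ball (P.gauge k X) (hw X) (K := fun σ' => K' σ' τ' X)
      (fun ψ => (hholσ τ' hτ' X ψ).congr (fun σ' hσ' => by simp only [hK'eq σ' hσ' τ' hτ']))
      (fun σ' hσ' => by rw [hK'eq σ' hσ' τ' hτ']; exact hKc σ' hσ' τ' hτ' X) (fun σ' hσ' => hT σ' hσ' τ' hτ') s hs' _ v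
  have hcoefτ : ∀ s : ℕ, s ≤ P.r₀ → ∀ v : Fin s → LinearMap.range (P.gauge k X), ∀ σ' ∈ ball (0 : ℂ) R,
      DifferentiableOn ℂ (fun τ' => iteratedFDeriv ℝ s (gaugeLift (P.gauge k X) (K' σ' τ' X))
        ((P.gauge k X).rangeRestrict φ) v) (ball (0 : ℂ) R) := by
    intro s hs' v σ' hσ'
    refine coeff_holomorphic_of_pointwise isOpen_ball (P.gauge k X) (hw X) (K := fun τ' => K' σ' τ' X)
      (fun ψ => (hholτ σ' hσ' X ψ).congr (fun τ' hτ' => by simp only [hK'eq σ' hσ' τ' hτ']))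
      (fun τ' hτ' => by rw [hK'eq σ' hσ' τ' hτ']; exact hKc σ' hσ' τ' hτ' X) (fun τ' hτ' => hT σ' hσ' τ' hτ') s hs' _ v
  have h := tayNorm_secondDiff_le_of_holomorphic_coeff (P.gauge k X) P.r₀ (K := fun σ' τ' ψ => K' σ' τ' X ψ)
    (M := C * P.aFactor k X * P.W.weight k X φ) (fun σ' τ' => hK'c σ' τ' X) φ hcoefσ hcoefτ
    (fun σ' hσ' τ' hτ' => by have := hT σ' hσ' τ' hτ' φ; simpa [mul_assoc] using this) hσ hτ
  have e1 : K' σ τ X = K σ τ X := by rw [hK'eq σ hσ τ hτ]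
  have e2 : K' σ 0 X = K σ 0 X := by rw [hK'eq σ hσ 0 h0]
  have e3 : K' 0 τ X = K 0 τ X := by rw [hK'eq 0 h0 τ hτ]
  have e4 : K' 0 0 X = K 0 0 X := by rw [hK'eq 0 h0 0 h0]
  simp only [e1, e2, e3, e4] at h
  calc tayNorm (P.gauge k X) P.r₀ (fun ψ => K σ τ X ψ - K σ 0 X ψ - K 0 τ X ψ + K 0 0 X ψ) φ
      ≤ ((P.r₀ : ℝ) + 1) * (4 * (C * P.aFactor k X * P.W.weight k X φ) / R ^ 2) * ‖σ‖ * ‖τ‖ := h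
    _ = ((P.r₀ : ℝ) + 1) * (4 * C / R ^ 2) * ‖σ‖ * ‖τ‖ * P.aFactor k X * P.W.weight k X φ := by ring

end Polymer

end Summit.HubbardSuperconductivity.HubbardSuperconductivity.Theorems.ComplexGFF

end
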